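import Summits.KontsevichZagierPeriods.KontsevichZagierPeriods.Theses.ComplexOrientations
import Literature.NumberTheory.Transcendental.KZLogCalculusProofs
import Literature.NumberTheory.Transcendental.KZSemialgebraicComplex
import Literature.NumberTheory.Transcendental.SemialgebraicMapsProofs

/-!
# `OvalSector` (crux stmt-KontsevichZagierPeriods-11369), line `birth` — translating a disc

Route `KontsevichZagierPeriods/ComplexOrientations`, crux `OvalSector`. This file closes the
calculus stub `stub_translateDisc` of the registered skeleton `Lines/birth.lean`: for real-algebraic
`a`, `b`, `c` and an integrand-1 representation `s` over the open disc
`{(v₀ − a)² + (v₁ − b)² < c}`, there is an integrand-1 representation `d` over the centred open disc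
`{v₀² + v₁² < c}` with `[s] − [d] ∈ KZ.relations`.

The chain is ONE move of Kontsevich–Zagier's rule (2) (change of variables) along the translation
`Φ u = u + (a, b)` from the centred disc onto the disc centred at `(a, b)`: `Φ` is a
`ℚ`-semialgebraic map (its coordinates `u ⱼ + wⱼ` are sums of a coordinate polynomial and a
`ℚ`-definable real-algebraic constant), injective, with derivative the identity (Jacobian `1`), and
`1 = 1 · |det id|` on the centred disc (`KZ.changeOfVariablesRel_subset_relations`). The
representation `d` is built directly: its domain is `ℚ`-semialgebraic (`v₀² + v₁² − c < 0` with `c`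
`ℚ`-definable), its integrand is the constant `1`, and its integrability is transported from
`s.integrableOn` along the measure-preserving translation (`measurePreserving_add_right`).

References: M. Kontsevich, D. Zagier, *Periods* (2001), §1.1 (real algebraic parameters are
`ℚ`-definable), §1.2 rule (2); J. Bochnak, M. Coste, M.-F. Roy, *Real Algebraic Geometry* (1998),
§2.2; A. Huber, S. Müller-Stach, *Periods and Nori Motives* (2017), §13.1.
-/

noncomputable section

open Set MeasureTheory MvPolynomial
open Literature.NumberTheory.Transcendental Literature.ModelTheory.ExponentialFields
open Summit.KontsevichZagierPeriods.KontsevichZagierPeriods.Theses.ComplexOrientations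

namespace Summit.KontsevichZagierPeriods.ComplexOrientations.OvalSector

/-- The centred open disc `{v | v₀² + v₁² < c}` of real-algebraic radius² `c` is `ℚ`-semialgebraic:
it is the negativity set of the `ℚ`-semialgebraic function `v ↦ (v₀² + v₁²) − c` (a polynomial minus
a `ℚ`-definable constant). [cite: KontsevichZagier2001, §1.1] [cite: BochnakCosteRoy1998, §2.2] -/
theorem isSemialgebraic_centredDisc_translateDisc {c : ℝ} (hc : IsAlgebraic ℚ c) :
    IsSemialgebraic ℚ {v : Fin 2 → ℝ | v 0 ^ 2 + v 1 ^ 2 < c} := by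
  have hpoly : IsSemialgebraicFunOn ℚ (univ : Set (Fin 2 → ℝ))
      (fun v => MvPolynomial.aeval v ((X 0) ^ 2 + (X 1) ^ 2 : MvPolynomial (Fin 2) ℚ)) :=
    isSemialgebraicFunOn_aeval isSemialgebraic_univ _
  have hconst : IsSemialgebraicFunOn ℚ (univ : Set (Fin 2 → ℝ)) (fun _ => c) :=
    isSemialgebraicFunOn_const_of_isAlgebraic isSemialgebraic_univ hc
  have hsub : IsSemialgebraicFunOn ℚ (univ : Set (Fin 2 → ℝ))
      ((fun v => MvPolynomial.aeval v ((X 0) ^ 2 + (X 1) ^ 2 : MvPolynomial (Fin 2) ℚ)) -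
        fun _ => c) :=
    IsSemialgebraicFunOn.sub_holds hpoly hconst
  convert hsub.isSemialgebraic_sep_neg using 1
  ext v
  simp [sub_neg]

/-- **Translation by a real-algebraic vector is a `ℚ`-semialgebraic map**: if every coordinate
`w j` is algebraic over `ℚ`, then `u ↦ u + w` is `ℚ`-semialgebraic on every `ℚ`-semialgebraic set
(each coordinate `u j + w j` is the sum of the polynomial `X j` and a `ℚ`-definable constant).
[cite: KontsevichZagier2001, §1.1] [cite: BochnakCosteRoy1998, Prop. 2.2.6] -/
theorem isSemialgebraicMapOn_add_const_translateDisc {m : ℕ} {σ : Set (Fin m → ℝ)}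
    (hσ : IsSemialgebraic ℚ σ) {w : Fin m → ℝ} (hw : ∀ j, IsAlgebraic ℚ (w j)) :
    IsSemialgebraicMapOn ℚ σ (fun u => u + w) := by
  refine IsSemialgebraicMapOn.of_forall hσ fun j => ?_
  have h := IsSemialgebraicFunOn.add_holds
    (isSemialgebraicFunOn_aeval hσ (X j : MvPolynomial (Fin m) ℚ))
    (isSemialgebraicFunOn_const_of_isAlgebraic hσ (hw j))
  exact h.congr fun u _ => by simp

/-- **Stub `stub_translateDisc`** (calculus; translation of a disc to the origin is a move). For
real-algebraic `a`, `b`, `c` and an integrand-1 representation `s` over the open disc of radius² `c`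
centred at `(a, b)`, there is an integrand-1 representation `d` over the centred open disc of
radius² `c` with `[s] − [d] ∈ KZ.relations`: one rule-2 move along the translation
`u ↦ u + (a, b)` from the centred disc onto `s.domain` (a `ℚ`-semialgebraic map since `a`, `b` are
`ℚ`-definable; identity derivative, Jacobian `1`), read backwards.
[cite: KontsevichZagier2001, §1.2 rule (2)] [cite: BochnakCosteRoy1998, §2.2] -/
theorem stub_translateDisc (a b c : ℝ) (ha : IsAlgebraic ℚ a) (hb : IsAlgebraic ℚ b)
    (hc : IsAlgebraic ℚ c) (s : KZ.IntegralRep 2)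
    (hs : s.domain = {v : Fin 2 → ℝ | (v 0 - a) ^ 2 + (v 1 - b) ^ 2 < c})
    (hs1 : ∀ v ∈ s.domain, s.integrand v = 1) :
    ∃ d : KZ.IntegralRep 2, d.domain = {v : Fin 2 → ℝ | v 0 ^ 2 + v 1 ^ 2 < c} ∧
      (∀ v ∈ d.domain, d.integrand v = 1) ∧ KZ.of s - KZ.of d ∈ KZ.relations := by
  -- the translation vector `w = (a, b)`
  obtain ⟨w, hw0, hw1, hw⟩ :
      ∃ w : Fin 2 → ℝ, w 0 = a ∧ w 1 = b ∧ ∀ j, IsAlgebraic ℚ (w j) :=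
    ⟨![a, b], by simp, by simp, fun j => by fin_cases j <;> simpa⟩
  set D : Set (Fin 2 → ℝ) := {v : Fin 2 → ℝ | v 0 ^ 2 + v 1 ^ 2 < c} with hD_def
  have hD : IsSemialgebraic ℚ D := isSemialgebraic_centredDisc_translateDisc hc
  -- the centred disc is the pull-back of `s.domain` along the translation
  have hpre : (fun u => u + w) ⁻¹' s.domain = D := by
    ext u
    simp [hs, hD_def, hw0, hw1]
  have hdom : s.domain = (fun u => u + w) '' D := by
    rw [← hpre]
    refine Subset.antisymm (fun v hv => ⟨v - w, ?_, sub_add_cancel v w⟩) (image_preimage_subset _ _)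
    simpa using hv
  -- the representation `d = [D, 1]`; integrability transported from `s` along the translation
  have hDmeas : MeasurableSet D :=
    (isOpen_lt (by fun_prop) continuous_const).measurableSet
  have hint1 : IntegrableOn (fun _ => (1 : ℝ)) D := by
    have h : IntegrableOn (fun u => s.integrand (u + w)) ((fun u => u + w) ⁻¹' s.domain) :=
      ((measurePreserving_add_right volume w).integrableOn_comp_preimage
        (measurableEmbedding_addRight w)).mpr s.integrableOn
    rw [hpre] at h
    refine h.congr_fun (fun u hu => hs1 _ ?_) hDmeas
    rw [← hpre] at hu
    exact hu
  let d : KZ.IntegralRep 2 :=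
    ⟨D, fun _ => 1, hD, isSemialgebraicFunOn_const_of_isAlgebraic hD isAlgebraic_one, hint1⟩
  refine ⟨d, rfl, fun _ _ => rfl, ?_⟩
  -- the move `[d] − [s] ∈ changeOfVariablesRel` along `Φ u = u + w`, `Φ' = id`
  have hmove : KZ.of d - KZ.of s ∈ KZ.changeOfVariablesRel := by
    refine ⟨2, d, s, fun u => u + w, fun _ => ContinuousLinearMap.id ℝ _,
      isSemialgebraicMapOn_add_const_translateDisc hD hw,
      fun u _ => ((hasFDerivAt_id u).add_const w).hasFDerivWithinAt,
      fun u _ v _ h => add_right_cancel h, hdom, fun u hu => ?_, rfl⟩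
    have hu' : u + w ∈ s.domain := by
      rw [hdom]
      exact mem_image_of_mem _ hu
    have hdet : (ContinuousLinearMap.id ℝ (Fin 2 → ℝ)).det = 1 := by
      rw [ContinuousLinearMap.det, ContinuousLinearMap.coe_id, LinearMap.det_id]
    simp [d, hs1 _ hu', hdet]
  have h := KZ.relations.neg_mem (KZ.changeOfVariablesRel_subset_relations hmove)
  rwa [neg_sub] at h

end Summit.KontsevichZagierPeriods.ComplexOrientations.OvalSector

end
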